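import Literature.NumberTheory.LFunctions.WeilWindowCertifiedProfile
import Literature.NumberTheory.LFunctions.YoshidaCompletedFormDegeneracy
import HarnessLib

/-!
# RH-CONDITIONAL — «nothing here bears on the truth of RH»
# Chuk 2026, Prop 4 («Assume RH … `Q(f) ≥ c_L‖f‖₂²` on every window»), DISCHARGED from the tree

Proof-only companion of `Literature/NumberTheory/LFunctions/WeilWindowCertifiedProfile.lean` (the triage-typing of
M. Chuk, *Weil positivity in compact windows: certified two-sided bounds and a Landau–Widom decay law*,
arXiv:2608.24827v1, 25 Aug 2026, bib `Chuk2026WeilWindows`). It discharges the named fact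

* `Chuk2026_prop4` — «PROPOSITION 4. Assume RH. For every `L > 0` there is `c_L > 0` such that `Q(f) ≥ c_L‖f‖₂²` for all
  admissible `f` supported in `[−L, L]`; in particular `λ*(L) > 0`.» (p. 4; printed with a proof SKETCH only: Paley–Wiener,
  Littlewood's gaps `γ_{n+1} − γ_n → 0` under RH, Beurling's sampling theorem for a `π/(4L)`-separated subset of `{±γ}`;
  «No effective `c_L` comes out of the argument»)

as `Chuk2026_prop4_holds`, by a DIFFERENT road than the printed sketch, entirely inside the tree and without any sampling
theorem: under RH the bottom `ε(L)` of Weil's form on the window is STRICTLY positive —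
`formLowerBound_pos_of_riemannHypothesis` (`YoshidaCompletedFormDegeneracy.lean`: attainment of the infimum on the
completed form domain, Bombieri 2000 §4 Thm 3, plus positive DEFINITENESS of the completed form under RH, Yoshida 1992
Thm 2 `⟹`, i.e. a null vector would have a transform vanishing at every non-trivial zero and hence vanish) together with the
form-core identification `YoshidaCompletedForm.formLowerBound_eq_weilGroundEnergy` (`inf` over the `L²` form domain =
`inf` over smooth test functions = the tree's `weilGroundEnergy L`) — and `ε(L)·‖g‖₂² ≤ Re Q(g)` for every test function of
the window (`ConnesVanSuijlekom.weilGroundEnergy_mul_le_re`). The constant is `c_L = ε(L)` itself (optimal, and exactly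
as ineffective as the print says). The printed restriction to real even `f` is not needed: the parity- and phase-free
statement is `weilQuadratic_coercive_of_riemannHypothesis`, and the sector forms `0 < ε_ev(L)`, `0 < ε_od(L)` follow from
`ε ≤ ε_ev`, `ε ≤ ε_od`.

Nothing here is, or is worded as, progress toward RH: every statement of this file has Mathlib's `RiemannHypothesis` as an
explicit hypothesis; the unconditional direction «`∀ L, ε(L) ≥ 0` ⟹ RH» is `riemannHypothesis_iff_forall_weilPositivityOn`.

## References

* [Chuk2026WeilWindows] M. Chuk, arXiv:2608.24827v1 (2026), Prop. 4 (p. 4) — statement; the proof here is not the printed one.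
* [Bombieri2000Weil] E. Bombieri, Rend. Mat. Acc. Lincei (9) 11 (2000) 183–233, §4 Thm 3 (attainment) — via the tree.
* [Yoshida1992HermitianForms] H. Yoshida, Adv. Stud. Pure Math. 21 (1992) 281–325, Thm 2 (definiteness under RH) — via the tree.
-/

noncomputable section

open Complex Filter Set MeasureTheory
open scoped Real Topology

namespace Literature.NumberTheory.LFunctions

/-- **Under RH the ground energy of every window is strictly positive**, `0 < ε(L)` for `L > 0` — the Literature-side
form of the statement (the completed-space theorem `formLowerBound_pos_of_riemannHypothesis` read through the form-core
identification `YoshidaCompletedForm.formLowerBound_eq_weilGroundEnergy`). The summit tree proves the same statement by a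
completion-free road as `Summit.RiemannHypothesis.RiemannHypothesis.Theorems.weilGroundEnergy_pos_of_riemannHypothesis`
(`SoloInformedNonDegenerate.lean`), which Literature files cannot import; hence the primed Literature-side restatement.
RH-CONDITIONAL. [cite: Yoshida1992HermitianForms, Thm. 2 (p. 321)] [cite: Bombieri2000Weil, §4 Thm. 3 (p. 196)] -/
theorem weilGroundEnergy_pos_of_riemannHypothesis' (hRH : RiemannHypothesis) {L : ℝ} (hL : 0 < L) :
    0 < weilGroundEnergy L := by
  rw [← YoshidaCompletedForm.formLowerBound_eq_weilGroundEnergy hL]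
  exact formLowerBound_pos_of_riemannHypothesis hRH hL

/-- **Coercivity on every window under RH, all test functions** (no parity, no reality condition): for `L > 0` there is
`c > 0` — namely `c = ε(L)` — with `c·∫|g|² ≤ Re Q(g)` for every test function `g` with `tsupport g ⊆ [−L, L]`.
RH-CONDITIONAL. [cite: Chuk2026WeilWindows, Prop. 4 (p. 4), the «in particular λ*(L) > 0» clause for all sectors] -/
theorem weilQuadratic_coercive_of_riemannHypothesis (hRH : RiemannHypothesis) {L : ℝ} (hL : 0 < L) :
    ∃ c : ℝ, 0 < c ∧ ∀ g : ℝ → ℂ, IsWeilTest g → tsupport g ⊆ Icc (-L) L →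
      c * ∫ t, ‖g t‖ ^ 2 ≤ (weilQuadratic g).re :=
  ⟨weilGroundEnergy L, weilGroundEnergy_pos_of_riemannHypothesis' hRH hL,
    fun _ hg hsupp ↦ ConnesVanSuijlekom.weilGroundEnergy_mul_le_re hg hsupp⟩

/-- Under RH both parity sectors of every window are coercive: `0 < ε_ev(L)` and `0 < ε_od(L)` (`ε ≤ ε_ev`, `ε ≤ ε_od`).
RH-CONDITIONAL. [cite: Chuk2026WeilWindows, Prop. 4 with §4 («Theorem 7 applies verbatim to each sector»)] -/
theorem weilEvenGroundEnergy_pos_and_weilOddGroundEnergy_pos_of_riemannHypothesis (hRH : RiemannHypothesis) {L : ℝ}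
    (hL : 0 < L) : 0 < weilEvenGroundEnergy L ∧ 0 < weilOddGroundEnergy L :=
  have h := weilGroundEnergy_pos_of_riemannHypothesis' hRH hL
  ⟨h.trans_le (weilGroundEnergy_le_weilEvenGroundEnergy L), h.trans_le (weilGroundEnergy_le_weilOddGroundEnergy L)⟩

/-- **Chuk 2026, Prop. 4 — DISCHARGED**: «Assume RH. For every `L > 0` there is `c_L > 0` such that `Q(f) ≥ c_L‖f‖₂²` for
all admissible `f` supported in `[−L, L]`; in particular `λ*(L) > 0`», for the tree's smooth real-valued even test functions of
the window (the typed statement), with `c_L = ε(L)`. Not the printed Beurling-sampling sketch: attainment + definiteness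
under RH (`formLowerBound_pos_of_riemannHypothesis`) and the form-core identification. RH-CONDITIONAL.
[cite: Chuk2026WeilWindows, Prop. 4 (p. 4)] -/
theorem Chuk2026_prop4_holds : Chuk2026_prop4 := by
  intro hRH L hL
  obtain ⟨c, hc, h⟩ := weilQuadratic_coercive_of_riemannHypothesis hRH hL
  exact ⟨c, hc, fun g hg hsupp _ _ ↦ h g hg hsupp⟩

end Literature.NumberTheory.LFunctions

end
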